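import Literature.NumberTheory.QuadraticForms.HilbertSymbolBilinear
import HarnessLib

/-!
# The Hilbert symbol of a difference of two square classes: `(a − b, θ)_v = (−1)^{v(a − b) + v(θ)}` when `a` lies in the
# UNRAMIFIED class and `b` in the class of `θ`

Topic `NumberTheory/QuadraticForms`; namespace `Literature.NumberTheory.QuadraticForms`.  THEOREMS ONLY (no definition, no
instance, no notation, no named fact, no `sorry`).  Pure local algebra at a finite place `v` of a number field `K` (dyadic places
included), over the tree's bimultiplicativity of the local Hilbert symbol (★ `hilbertSymbol_adicCompletion_mul_left∕_right`,
O'Meara 63:13a) and the two trivial relations `(z, 1 − z)_v = 1` (Steinberg) and `(a, −a)_v = 1`.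

THE STATEMENT.  Call `a ∈ K_vˣ` of UNRAMIFIED CLASS when `(y, a)_v = 1 ⟺ v(y) is even` for every `y ≠ 0` — i.e. `K_v(√a)∕K_v` is the
unramified quadratic extension (its norm group is the subgroup of even valuation; Serre, *Local Fields* V §2 Prop. 3 + `v(N z) = 2 v(z)`).
Then for `θ ≠ 0`, `b = θ·c²` (any `c`) and `a ≠ b`:
  `(a − b, θ)_v = 1  ⟺  v(a − b) + v(θ)` is even.
PROOF (five lines of symbol calculus).  `a − b = a(1 − z)`, `z := b∕a ≠ 0, 1`.  `(a − b, θ) = (a, θ)(1 − z, θ)`; `(a, θ) = (θ, a) = (−1)^{v θ}`;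
`θ = z·a·c⁻²` so `(1 − z, θ) = (1 − z, z)(1 − z, a) = (1 − z, a) = (−1)^{v(1 − z)}`; finally `v(a)` is even because `(a, a) = (a, −a)(a, −1) =
(−1, a) = (−1)^{v(−1)} = 1`, so `v(a − b) ≡ v(1 − z)`.  (This is the classical «`⟨a, −θ⟩` represents `x` iff `(x, −a·(−θ)) = (a, −θ)`» read for the
unramified `a`.)
USE (crux H413, Track A «(D-RAM) FOUR-FRAME», unit U2H, (ρ2b′-X) organ O-Sign, LH4-p13): with `a = Tr_{K∕F}λ′ − 2` (unramified descent
field `K`), `b = Tr_{E∕F}u′ − 2 ∈ θ·F²`, `a − b` = the depth token `x` of Rogawski's factor `τ_v·D_{G∕H,v}`, this is the sign law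
`(β, θ)_v = (−1)^{m + v(θ)}` of the wild type-(2) fixed-point census (type U).
HONEST LABEL: count-neutral helper (`--supports stmt-HodgeConjecture-24833`); HC_CM is proved only modulo the 7 printed citations (2 remaining
named inputs: hLiu418 = stmt-HodgeConjecture-24832, h413 = stmt-HodgeConjecture-24833) until rung 0 closes.

## References
* [Omeara1963] O. T. O'Meara, *Introduction to Quadratic Forms*, Grundlehren 117, Springer (1963), §63B (63:10, 63:11, 63:13a), §63C Example 63:16.
* [Serre1979] J.-P. Serre, *Local Fields*, GTM 67, Springer (1979), Ch. V §2 Prop. 3, Ch. XIV §3 (the symbol `(a, b)_v`, Steinberg relation).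
-/

set_option autoImplicit false

noncomputable section

open NumberField IsDedekindDomain WithZero

namespace Literature.NumberTheory.QuadraticForms

/-! ## §1 Two trivial relations of the Hilbert symbol over any field -/

/-- **Steinberg relation** `(1 − z, z) = 1`: `(1 − z)·1² + z·1² = 1`. [cite: Omeara1963, §63B 63:11] [cite: Serre1979, Ch. XIV §3] -/
theorem hilbertSymbol_one_sub_self {F : Type*} [Field F] (z : F) : hilbertSymbol F (1 - z) z = 1 :=
  (hilbertSymbol_eq_one_iff _ _).2 ⟨1, 1, by ring⟩

/-- `(a, −a) = 1` for `a ≠ 0` (`char ≠ 2`): `a·x² − a·y² = 1` with `x = (1 + a⁻¹)∕2`, `y = (1 − a⁻¹)∕2`. [cite: Omeara1963, §63B 63:10] -/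
theorem hilbertSymbol_self_neg {F : Type*} [Field F] [NeZero (2 : F)] {a : F} (ha : a ≠ 0) :
    hilbertSymbol F a (-a) = 1 := by
  refine (hilbertSymbol_eq_one_iff _ _).2 ⟨(1 + a⁻¹) / 2, (1 - a⁻¹) / 2, ?_⟩
  have h2 : (2 : F) ≠ 0 := two_ne_zero
  field_simp
  ring

/-- Square-class invariance in the second variable: `(a, b·c²) = (a, b)` for `c ≠ 0`. [cite: Omeara1963, §63B 63:10] -/
theorem hilbertSymbol_mul_sq_right_of_ne_zero {F : Type*} [Field F] (a b : F) {c : F} (hc : c ≠ 0) :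
    hilbertSymbol F a (b * c ^ 2) = hilbertSymbol F a b := by
  have key : (∃ x y : F, a * x ^ 2 + b * c ^ 2 * y ^ 2 = 1) ↔ ∃ x y : F, a * x ^ 2 + b * y ^ 2 = 1 := by
    constructor
    · rintro ⟨x, y, h⟩
      exact ⟨x, c * y, by linear_combination h⟩
    · rintro ⟨x, y, h⟩
      refine ⟨x, y / c, ?_⟩
      rw [show b * c ^ 2 * (y / c) ^ 2 = b * y ^ 2 by field_simp]
      exact h
  by_cases h : ∃ x y : F, a * x ^ 2 + b * y ^ 2 = 1
  · rw [(hilbertSymbol_eq_one_iff _ _).2 h, (hilbertSymbol_eq_one_iff _ _).2 (key.2 h)]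
  · rw [(hilbertSymbol_eq_neg_one_iff _ _).2 h, (hilbertSymbol_eq_neg_one_iff _ _).2 fun h' => h (key.1 h')]

/-- For two signs `p q ∈ {±1}`: `p·q = 1 ⟺ (p = 1 ⟺ q = 1)`. [folklore] -/
private theorem mul_eq_one_iff_of_sign {p q : ℤ} (hp : p = 1 ∨ p = -1) (hq : q = 1 ∨ q = -1) :
    p * q = 1 ↔ (p = 1 ↔ q = 1) := by
  rcases hp with rfl | rfl <;> rcases hq with rfl | rfl <;> decide

/-! ## §2 The difference of the unramified class and the class of `θ` -/

variable (K : Type) [Field K] [NumberField K] (v : HeightOneSpectrum (𝓞 K))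

/-- **An element of UNRAMIFIED CLASS has even valuation**: if `(y, a)_v = 1 ⟺ v(y)` even for all `y ≠ 0`, then `v(a)` is even —
because `(a, a)_v = (a, −a)_v (a, −1)_v = (−1, a)_v = 1`. [cite: Omeara1963, §63B 63:10] [cite: Serre1979, Ch. V §2 Prop. 3] -/
theorem even_log_valued_of_unramifiedClass {a : v.adicCompletion K} (ha : a ≠ 0)
    (hA : ∀ y : v.adicCompletion K, y ≠ 0 →
      (hilbertSymbol (v.adicCompletion K) y a = 1 ↔ Even (log (Valued.v y)))) :
    Even (log (Valued.v a)) := by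
  haveI : CharZero (v.adicCompletion K) := charZero_of_injective_algebraMap (algebraMap K _).injective
  haveI : NeZero (2 : v.adicCompletion K) := ⟨two_ne_zero⟩
  have hna : (-a : v.adicCompletion K) ≠ 0 := neg_ne_zero.2 ha
  have hn1 : (-1 : v.adicCompletion K) ≠ 0 := neg_ne_zero.2 one_ne_zero
  -- `(a, a) = (a, −a)·(a, −1) = (−1, a)`
  have h1 : hilbertSymbol (v.adicCompletion K) a a = hilbertSymbol (v.adicCompletion K) (-1) a := by
    have h := hilbertSymbol_adicCompletion_mul_right K v hna hn1 ha
    rw [show (-a : v.adicCompletion K) * -1 = a by ring, hilbertSymbol_self_neg ha, one_mul, hilbertSymbol_comm a (-1)] at h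
    exact h
  -- `(−1, a) = 1` since `v(−1) = 0` is even
  have h2 : hilbertSymbol (v.adicCompletion K) (-1) a = 1 := by
    rw [hA (-1) hn1, Valuation.map_neg, Valuation.map_one, log_one]
    exact Even.zero
  exact (hA a ha).1 (h1.trans h2)

/-- **THE DIFFERENCE OF THE UNRAMIFIED CLASS AND THE CLASS OF `θ`.**  At a finite place `v` of a number field (any residue characteristic):
if `a` is of UNRAMIFIED CLASS (`(y, a)_v = 1 ⟺ v(y)` even, all `y ≠ 0`), `θ ≠ 0`, `b = θ·c²` (`c = 0` allowed), and `a ≠ b`, then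
**`(a − b, θ)_v = 1 ⟺ v(a − b) + v(θ)` is even**, i.e. `(a − b, θ)_v = (−1)^{v(a−b) + v(θ)}`.
Symbol calculus: `(a − b, θ) = (a, θ)(1 − b∕a, θ)`, `(a, θ) = (−1)^{v θ}`, `(1 − z, θ) = (1 − z, z·a·c⁻²) = (1 − z, z)(1 − z, a) = (−1)^{v(1−z)}`, `v(a)` even.
[cite: Omeara1963, §63B 63:10–63:13a, §63C Example 63:16] [cite: Serre1979, Ch. XIV §3; Ch. V §2 Prop. 3] -/
theorem hilbertSymbol_sub_eq_one_iff_of_unramifiedClass {a b θ c : v.adicCompletion K} (ha : a ≠ 0) (hθ : θ ≠ 0)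
    (hb : b = θ * c ^ 2) (hab : a ≠ b)
    (hA : ∀ y : v.adicCompletion K, y ≠ 0 →
      (hilbertSymbol (v.adicCompletion K) y a = 1 ↔ Even (log (Valued.v y)))) :
    hilbertSymbol (v.adicCompletion K) (a - b) θ = 1 ↔ Even (log (Valued.v (a - b)) + log (Valued.v θ)) := by
  haveI : CharZero (v.adicCompletion K) := charZero_of_injective_algebraMap (algebraMap K _).injective
  haveI : NeZero (2 : v.adicCompletion K) := ⟨two_ne_zero⟩
  have hva : Even (log (Valued.v a)) := even_log_valued_of_unramifiedClass K v ha hA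
  -- degenerate case `c = 0`: `b = 0`, `(a, θ) = (θ, a) = (−1)^{v θ}` and `v(a)` is even
  rcases eq_or_ne c 0 with rfl | hc
  · have hb0 : b = 0 := by rw [hb]; ring
    rw [hb0, sub_zero, hilbertSymbol_comm, hA θ hθ, Int.even_add]
    exact ⟨fun h => iff_of_true hva h, fun h => h.1 hva⟩
  have hb0 : b ≠ 0 := by rw [hb]; exact mul_ne_zero hθ (pow_ne_zero _ hc)
  set z : v.adicCompletion K := b / a with hz
  have hz0 : z ≠ 0 := div_ne_zero hb0 ha
  have h1z : (1 - z) ≠ 0 := by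
    intro h
    have hz1 : z = 1 := (sub_eq_zero.1 h).symm
    rw [hz, div_eq_one_iff_eq ha] at hz1
    exact hab hz1.symm
  have hsplit : a - b = a * (1 - z) := by rw [hz]; field_simp
  -- `(a − b, θ) = (θ, a)·(1 − z, a)`
  have hθ' : θ = z * a * (c⁻¹) ^ 2 := by
    have hza : z * a = θ * c ^ 2 := by rw [hz, div_mul_cancel₀ _ ha, hb]
    rw [hza]; field_simp
  have hprod : hilbertSymbol (v.adicCompletion K) (a - b) θ =
      hilbertSymbol (v.adicCompletion K) θ a * hilbertSymbol (v.adicCompletion K) (1 - z) a := by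
    rw [hsplit, hilbertSymbol_adicCompletion_mul_left K v ha h1z hθ, hilbertSymbol_comm a θ]
    congr 1
    rw [hθ', hilbertSymbol_mul_sq_right_of_ne_zero _ _ (inv_ne_zero hc), hilbertSymbol_adicCompletion_mul_right K v hz0 ha h1z,
      hilbertSymbol_one_sub_self, one_mul]
  -- valuations: `v(a − b) = v(a)·v(1 − z)`, `v(a)` even
  have hlog : log (Valued.v (a - b)) = log (Valued.v a) + log (Valued.v (1 - z)) := by
    rw [hsplit, Valuation.map_mul, log_mul ((Valuation.ne_zero_iff _).2 ha) ((Valuation.ne_zero_iff _).2 h1z)]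
  rw [hprod, mul_eq_one_iff_of_sign (hilbertSymbol_eq_one_or_eq_neg_one θ a) (hilbertSymbol_eq_one_or_eq_neg_one (1 - z) a),
    hA θ hθ, hA (1 - z) h1z, hlog, Int.even_add, Int.even_add]
  constructor
  · intro h
    exact ⟨fun hrq => h.2 (hrq.1 hva), fun hp => iff_of_true hva (h.1 hp)⟩
  · intro h
    exact ⟨fun hp => (h.2 hp).1 hva, fun hq => h.1 (iff_of_true hva hq)⟩

/-! ## §3 (ED. 2) The general identity behind §2: `(a − b, θ)_v = (a, −θ)_v · (a − b, a)_v` for `b ∈ θ·F_v²` -/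

/-- **THE DIFFERENCE OF TWO SQUARE CLASSES, GENERAL FORM.**  At a finite place `v`: for `a ≠ 0`, `θ ≠ 0`, `b = θ·c²` (`c = 0` allowed) and `a ≠ b`,
**`(a − b, θ)_v = (a, −θ)_v · (a − b, a)_v`** — the second factor is the norm-residue of `a − b` for `F_v(√a)`.  (Symbol calculus: `(a − b, θ) = (a, θ)(1 − z, θ)`,
`(1 − z, θ) = (1 − z, z·a) = (1 − z, a)`, and `(a − b, a) = (a, a)(1 − z, a) = (a, −1)(1 − z, a)`.)  When `a` is of UNRAMIFIED class the two factors are `(−1)^{v θ}` and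
`(−1)^{v(a−b)}` and §2 results; for a RAMIFIED class `a` (descent types RK∕RM of the (ρ2b′-X) census) the second factor is a genuine `F_v(√a)`-side symbol.
[cite: Omeara1963, §63B 63:10–63:13a] [cite: Serre1979, Ch. XIV §3] -/
theorem hilbertSymbol_sub_eq_mul_of_sqClass {a b θ c : v.adicCompletion K} (ha : a ≠ 0) (hθ : θ ≠ 0) (hb : b = θ * c ^ 2) (hab : a ≠ b) :
    hilbertSymbol (v.adicCompletion K) (a - b) θ =
      hilbertSymbol (v.adicCompletion K) a (-θ) * hilbertSymbol (v.adicCompletion K) (a - b) a := by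
  haveI : CharZero (v.adicCompletion K) := charZero_of_injective_algebraMap (algebraMap K _).injective
  haveI : NeZero (2 : v.adicCompletion K) := ⟨two_ne_zero⟩
  have hab0 : a - b ≠ 0 := sub_ne_zero.2 hab
  have hn1 : (-1 : v.adicCompletion K) ≠ 0 := neg_ne_zero.2 one_ne_zero
  -- `(a, −θ) = (a, θ)(a, −1)` and `(a − b, a) = (a, a − b)`; `(a, a) = (a, −1)`
  have haa : hilbertSymbol (v.adicCompletion K) a a = hilbertSymbol (v.adicCompletion K) a (-1) := by
    have h := hilbertSymbol_adicCompletion_mul_right K v (neg_ne_zero.2 ha) hn1 ha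
    rw [show (-a : v.adicCompletion K) * -1 = a by ring, hilbertSymbol_self_neg ha, one_mul] at h
    exact h
  have hsq : hilbertSymbol (v.adicCompletion K) a (-1) * hilbertSymbol (v.adicCompletion K) a (-1) = 1 := by
    rcases hilbertSymbol_eq_one_or_eq_neg_one a (-1 : v.adicCompletion K) with h | h <;> rw [h] <;> norm_num
  have hnegθ : hilbertSymbol (v.adicCompletion K) a (-θ) =
      hilbertSymbol (v.adicCompletion K) a θ * hilbertSymbol (v.adicCompletion K) a (-1) := by
    rw [show (-θ : v.adicCompletion K) = θ * -1 by ring, hilbertSymbol_adicCompletion_mul_right K v hθ hn1 ha]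
  rcases eq_or_ne c 0 with rfl | hc
  · -- `b = 0`: `(a, θ) = (a, −θ)(a, a)` since `(a, a) = (a, −1)` and `(a, −1)² = 1`
    have hb0 : b = 0 := by rw [hb]; ring
    rw [hb0, sub_zero, haa, hnegθ, mul_assoc, hsq, mul_one, hilbertSymbol_comm]
  have hb0 : b ≠ 0 := by rw [hb]; exact mul_ne_zero hθ (pow_ne_zero _ hc)
  set z : v.adicCompletion K := b / a with hz
  have hz0 : z ≠ 0 := div_ne_zero hb0 ha
  have h1z : (1 - z) ≠ 0 := by
    intro h
    have hz1 : z = 1 := (sub_eq_zero.1 h).symm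
    rw [hz, div_eq_one_iff_eq ha] at hz1
    exact hab hz1.symm
  have hsplit : a - b = a * (1 - z) := by rw [hz]; field_simp
  have hθ' : θ = z * a * (c⁻¹) ^ 2 := by
    have hza : z * a = θ * c ^ 2 := by rw [hz, div_mul_cancel₀ _ ha, hb]
    rw [hza]; field_simp
  -- `(1 − z, θ) = (1 − z, a)`
  have h1zθ : hilbertSymbol (v.adicCompletion K) (1 - z) θ = hilbertSymbol (v.adicCompletion K) (1 - z) a := by
    rw [hθ', hilbertSymbol_mul_sq_right_of_ne_zero _ _ (inv_ne_zero hc), hilbertSymbol_adicCompletion_mul_right K v hz0 ha h1z,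
      hilbertSymbol_one_sub_self, one_mul]
  -- `(a − b, θ) = (θ, a)(1 − z, a)` and `(a − b, a) = (a, −1)(1 − z, a)`
  have hL : hilbertSymbol (v.adicCompletion K) (a - b) θ =
      hilbertSymbol (v.adicCompletion K) a θ * hilbertSymbol (v.adicCompletion K) (1 - z) a := by
    rw [hsplit, hilbertSymbol_adicCompletion_mul_left K v ha h1z hθ, h1zθ]
  have hR : hilbertSymbol (v.adicCompletion K) (a - b) a =
      hilbertSymbol (v.adicCompletion K) a (-1) * hilbertSymbol (v.adicCompletion K) (1 - z) a := by
    rw [hsplit, hilbertSymbol_adicCompletion_mul_left K v ha h1z ha, haa]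
  rw [hL, hR, hnegθ]
  linear_combination -(hilbertSymbol (v.adicCompletion K) a θ * hilbertSymbol (v.adicCompletion K) (1 - z) a) * hsq

end Literature.NumberTheory.QuadraticForms

end
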